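import Literature.Computability.Cryptography.ComPRGModel
import Literature.Computability.Cryptography.LeftoverHashSmooth
import HarnessLib

/-!
# A pseudorandom generator from a bit-commitment scheme, IV: the two hashing steps (Luby 1996, Thm. 10.3, Steps 1 and 3)

Topic `Literature/Computability/Cryptography`; sequel of `ComPRGModel.lean`. For the good candidate of level `n`
(`kGood n`: the honest coin count and the entropy guess `jStar n = ⌊4·H(C)⌋`) this file proves the two
statistical steps of the proof of M. Luby, *Pseudorandomness and Cryptographic Applications* (1996), Lecture 10,
Thm. 10.3, in the tree's model, as bounds on the acceptance probabilities of an arbitrary distinguisher `D`: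

* **`step1`** — `|Pr[D(cand(U)) = 1] − Pr[D(X S 0) = 1]| ≤ ½·2^{−(n+1)} + e^{−2(n+1)}` as soon as
  `5·t·√p ≤ 1` (`p` the fraction of ambiguous `0`-blocks, `≤ bindingError/2`): the hash of the seed blocks given
  the committed pairs is replaced by fresh bits (Step 1: conditional flattening of `H(Y | f'(Y))` and the
  Leftover Hash Lemma — `LeftoverHash.smooth_cond_test` — the entropy deficiency `H(C, B) − H(C) ≤ 5√p` of
  `BindingEntropyGap.lean` paying for the one-sided binding);
* **`step3`** — `|Pr[D(X S t) = 1] − Pr[D(U_{a+1}) = 1]| ≤ ½·2^{−(n+1)} + e^{−2(n+1)}`: the hash of the ideal pairs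
  `(commit(bℓ; rℓ), uℓ)` (entropy `H(C) + 1` each) is replaced by fresh bits, after which the string is exactly
  uniform (Step 3: flattening and the Leftover Hash Lemma — `LeftoverHash.smooth_test`).

The computational Step 2 (`X S 0 ≈ X S t`, from hiding) is the sequel. Contents: generic bookkeeping of uniform
averages over coded tuples (`uniformAvg_codec`, `uniformAvg_take_left`, `sum_encZ`, marginalising the fresh bits
`avg_zH_zero`), the two identifications of iterated averages with the test-form sums of `LeftoverHashSmooth.lean`,
the parameter inequalities (`tηL0 = Δ`, `e^{−2tη²} = e^{−2(n+1)}`, the exponents of Steps 1 and 3), and the two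
theorems. All proved; no named facts.

## References

* M. Luby, *Pseudorandomness and Cryptographic Applications*, Princeton University Press 1996, Lecture 10,
  Thm. 10.3 (proof, Steps 1 and 3), Lecture 8 (Smoothing Entropy Theorem).
* J. Håstad, R. Impagliazzo, L. A. Levin, M. Luby, SIAM J. Comput. 28 (1999), Lemma 4.8, §4.5.
-/

namespace Literature.Computability.Cryptography

open _root_.Computability Complexity Complexity.Brick Complexity.BitCodec Polynomial Hybrid AffineStr Finset HHRVW
  FalseEntropy RepSampI LeftoverHash

namespace ComPRG

/-! ### Uniform averages over codes -/

section Averages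

/-- `E_{U_0} g = g ε` (private twin of `Schoening.uniformAvg_zero`; belongs next to `uniformAvg` in
`StatisticalDistance.lean` — librarian move). [folklore] -/
private theorem uniformAvg_zero (g : List Bool → ℝ) : uniformAvg 0 g = g [] := by
  rw [uniformAvg_congr (g := fun _ => g []) fun x hx => by rw [List.eq_nil_of_length_eq_zero hx], uniformAvg_const]

/-- **A uniform average over `{0,1}^{len}` is an average over the coded objects.** [folklore] -/
theorem uniformAvg_codec {α : Type*} [Fintype α] (c : BitCodec α) (g : List Bool → ℝ) :
    uniformAvg c.len g = (∑ a : α, g (c.enc a)) / 2 ^ c.len := by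
  unfold uniformAvg
  rw [c.sum_vector_eq]

/-- **A prefix of a uniform string is uniform**: `E_{y ← U_{m+r}} g(y ↾ m) = E_{U_m} g`. [folklore] -/
theorem uniformAvg_take_left (m r : ℕ) (g : List Bool → ℝ) :
    uniformAvg (m + r) (fun y => g (y.take m)) = uniformAvg m g := by
  rw [uniformAvg_append]
  refine uniformAvg_congr fun u hu => ?_
  rw [uniformAvg_congr (g := fun _ => g u) fun w _ => by
    show g ((u ++ w).take m) = g u
    rw [List.take_append_of_le_length hu.ge, List.take_of_length_le hu.le], uniformAvg_const]

/-- The string of an `𝔽₂`-vector read off a bit vector is the bit vector. [folklore] -/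
theorem encZ_toZ' (k : ℕ) (v : List.Vector Bool k) : encZ k (Stockmeyer.toZ v) = v.toList := by
  have h : encZ k (Stockmeyer.toZ v) = List.ofFn v.get := by
    unfold encZ Stockmeyer.toZ
    congr 1
    funext i
    simp
  rw [h, ← List.Vector.toList_ofFn, List.Vector.ofFn_get]

/-- **Summing over `𝔽₂^k` through `encZ` is summing over `{0,1}^k`.** [folklore] -/
theorem sum_encZ {M : Type*} [AddCommMonoid M] (k : ℕ) (G : List Bool → M) :
    ∑ u : Fin k → ZMod 2, G (encZ k u) = ∑ v : List.Vector Bool k, G v.toList := by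
  have hbij : Function.Bijective (Stockmeyer.toZ (m := k)) := by
    rw [Fintype.bijective_iff_injective_and_card]
    refine ⟨Stockmeyer.toZ_injective, ?_⟩
    rw [card_vector, Fintype.card_pi, Finset.prod_const, ZMod.card, Finset.card_univ, Fintype.card_fin, Fintype.card_bool]
  exact (Fintype.sum_bijective _ hbij (fun v => G v.toList) (fun u => G (encZ k u)) fun v => by rw [encZ_toZ']).symm

/-- `|{0,1}^k → 𝔽₂| = 2^k` (private twin of `HHRVW.card_zfun`). [folklore] -/
private theorem card_bvec (k : ℕ) : Fintype.card (Fin k → ZMod 2) = 2 ^ k := by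
  rw [Fintype.card_pi, Finset.prod_const, ZMod.card, Finset.card_univ, Fintype.card_fin]

/-- **A double uniform average (key, coded object) as one quotient** (the shape of the test-form hashing
lemmas). [folklore] -/
theorem uniformAvg₂_eq_div {α : Type*} [Fintype α] (K : ℕ) (c : BitCodec α) (G : List Bool → List Bool → ℝ) :
    uniformAvg K (fun κ => uniformAvg c.len fun x => G κ x) =
      (∑ κ : List.Vector Bool K, ∑ a : α, G κ.toList (c.enc a)) /
        ((Finset.univ : Finset (List.Vector Bool K)).card * Fintype.card α) := by
  simp only [uniformAvg, c.sum_vector_eq, Finset.sum_div]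
  rw [Finset.card_univ, card_vector, Fintype.card_bool, c.card_eq]
  push_cast
  refine Finset.sum_congr rfl fun κ _ => Finset.sum_congr rfl fun a _ => ?_
  rw [div_div, mul_comm]

/-- A uniform average over `m`-bit strings as a sum over `𝔽₂^m`. [folklore] -/
theorem uniformAvg_eq_sum_encZ (m : ℕ) (g : List Bool → ℝ) :
    uniformAvg m g = (∑ v : Fin m → ZMod 2, g (encZ m v)) / Fintype.card (Fin m → ZMod 2) := by
  unfold uniformAvg
  rw [sum_encZ, card_bvec]
  push_cast
  rfl

/-- **A triple uniform average (key, coded object, `m`-bit string) as one quotient**, the innermost average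
read through `encZ`. [folklore] -/
theorem uniformAvg₃_eq_div {α : Type*} [Fintype α] (K : ℕ) (c : BitCodec α) (m : ℕ) (G : List Bool → List Bool → List Bool → ℝ) :
    uniformAvg K (fun κ => uniformAvg c.len fun x => uniformAvg m fun u => G κ x u) =
      (∑ κ : List.Vector Bool K, ∑ a : α, ∑ v : Fin m → ZMod 2, G κ.toList (c.enc a) (encZ m v)) /
        ((Finset.univ : Finset (List.Vector Bool K)).card * Fintype.card α * Fintype.card (Fin m → ZMod 2)) := by
  rw [uniformAvg₂_eq_div]
  simp only [uniformAvg_eq_sum_encZ, Finset.sum_div]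
  refine Finset.sum_congr rfl fun κ _ => Finset.sum_congr rfl fun a _ => Finset.sum_congr rfl fun v _ => ?_
  rw [div_div]
  congr 1
  ring

end Averages

namespace Setup

variable (S : Setup)

/-! ### The fraction of ambiguous blocks -/

/-- **`pS n`**: the fraction of ambiguous `0`-blocks (a `0`-commitment that some `1`-block also produces).
[cite: Goldreich2001, Def. 4.4.1 (2) (unambiguity)] -/
noncomputable def pS (n : ℕ) : ℝ := ((ambig (S.Cm n) S.bitOf).card : ℝ) / Fintype.card (S.Blk n)

/-- `0 ≤ pS n`. [folklore] -/
theorem pS_nonneg (n : ℕ) : 0 ≤ S.pS n := by unfold pS; positivity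

/-- The entropy of the honest pair `HF n = H(Cm, bitOf)`. [folklore] -/
noncomputable def HF (n : ℕ) : ℝ := mapEntropy univ (S.Fm n)

/-- **`HF ≤ HC + 5√p`** (the entropy deficiency of one-sided binding). [cite: Luby1996, Lecture 10, Theorem 10.3 (false entropy of `⟨f(x), b⟩`)] -/
theorem HF_le (n : ℕ) : S.HF n ≤ S.HC n + 5 * Real.sqrt (S.pS n) := by
  have h := mapEntropy_pair_sub_le_sqrt (Cm := S.Cm n) (Bt := S.bitOf)
  unfold HF HC Fm pS
  linarith

/-- `realEntropy Fm = L0 − HF` (`H(X | F(X)) = H(X) − H(F(X))`). [cite: HaitnerEtAl2020, §2.3] -/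
theorem realEntropy_Fm (n : ℕ) : realEntropy (S.Fm n) = S.L0 n - S.HF n := by
  rw [realEntropy_eq_sub, mapEntropy_graph, logb_card_Blk, HF]

/-! ### The flattening parameters -/

/-- `ηS n = Δ / (t·L0)`: the normalised deviation with `t·η·log₂|Blk| = Δ` and `tη² = n + 1`. [folklore] -/
noncomputable def ηS (n : ℕ) : ℝ := (S.Δ n : ℝ) / (S.t n * S.L0 n)

/-- `0 ≤ ηS n`. [folklore] -/
theorem ηS_nonneg (n : ℕ) : 0 ≤ S.ηS n := by unfold ηS; positivity

/-- `t·ηS·log₂|Blk| = Δ`. [folklore] -/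
theorem t_mul_ηS (n : ℕ) : (S.t n : ℝ) * S.ηS n * Real.logb 2 (Fintype.card (S.Blk n)) = S.Δ n := by
  rw [logb_card_Blk, ηS]
  have ht : (0 : ℝ) < S.t n := by exact_mod_cast S.t_pos n
  have hL : (0 : ℝ) < S.L0 n := by exact_mod_cast S.one_le_L0 n
  field_simp

/-- `e^{−2·t·ηS²} = e^{−2(n+1)}`. [folklore] -/
theorem exp_ηS (n : ℕ) : Real.exp (-2 * S.t n * S.ηS n ^ 2) = Real.exp (-2 * (n + 1)) := by
  congr 1
  unfold ηS
  have ht : (S.t n : ℝ) = 4 * (S.cst n : ℝ) ^ 2 * (n + 1) := by unfold t t4; push_cast; ring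
  have hΔ : (S.Δ n : ℝ) = S.L0 n * (2 * S.cst n * (n + 1)) := by unfold Δ; push_cast; ring
  have hL : (0 : ℝ) < S.L0 n := by exact_mod_cast S.one_le_L0 n
  have hc : (0 : ℝ) < S.cst n := by have : 1 ≤ S.cst n := by unfold cst; omega
                                    exact_mod_cast this
  have hn : (0 : ℝ) < (n : ℝ) + 1 := by positivity
  rw [ht, hΔ]
  field_simp
  ring

/-- `e^{−2(n+1)} ≤ ½`. [folklore] -/
theorem exp_le_half (n : ℕ) : Real.exp (-2 * ((n : ℝ) + 1)) ≤ 2⁻¹ := by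
  have hn : (0 : ℝ) ≤ n := Nat.cast_nonneg n
  have h1 : Real.exp (-2 * ((n : ℝ) + 1)) ≤ Real.exp (-1) := Real.exp_le_exp.2 (by linarith)
  have h2 : Real.exp (-1) ≤ 2⁻¹ := by
    rw [Real.exp_neg, inv_le_inv₀ (Real.exp_pos 1) (by norm_num)]
    have := Real.add_one_le_exp (1 : ℝ)
    linarith
  exact h1.trans h2

/-! ### Step 1: the hash of the seed blocks is nearly uniform given the committed pairs -/

section Step1

variable {S}

/-- **Marginalising the fresh bits**: an average over the hybrid coins `R` of a function of the honest tuple `z₀(R)`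
is the average over seed blocks `x` of the same function of the candidate's tuple `zStr(x)`. [folklore] -/
theorem avg_zH_zero (hS : S.WF) (n : ℕ) (g : List Bool → ℝ) :
    uniformAvg (S.rLen n) (fun R => g (S.zH n (S.ρ n) 0 R)) = uniformAvg (S.xLen n) fun x => g (S.zStr n (S.ρ n) x) := by
  rw [show S.rLen n = (S.cR n).len from rfl, uniformAvg_codec, show S.xLen n = (S.cW n).len from rfl, uniformAvg_codec]
  simp only [S.zH_enc hS, S.zStr_enc, cR_len, cW_len]
  -- split `w' : Fin t → Blk × {0,1}` into its two components; the summand only depends on the first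
  have key : ∑ w : Fin (S.t n) → S.Blk n × List.Vector Bool 1, g (S.encT n (S.pairH n 0 w)) =
      ∑ p : (Fin (S.t n) → S.Blk n) × (Fin (S.t n) → List.Vector Bool 1), g (S.encT n (prodMap (S.Fm n) (S.t n) p.1)) := by
    refine Fintype.sum_equiv (Equiv.arrowProdEquivProdArrow (Fin (S.t n)) (fun _ => S.Blk n) fun _ => List.Vector Bool 1)
      _ _ fun w => ?_
    rw [S.pairH_zero, Equiv.arrowProdEquivProdArrow_apply]
  rw [key, Fintype.sum_prod_type]
  simp only [Finset.sum_const, Finset.card_univ, nsmul_eq_mul]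
  rw [← Finset.mul_sum, Fintype.card_pi, Finset.prod_const, card_vector, Fintype.card_bool, Finset.card_univ,
    Fintype.card_fin, pow_one, rLen, xLen, Nat.mul_succ, pow_add, Nat.cast_pow, Nat.cast_ofNat]
  have h2 : (0 : ℝ) < 2 ^ S.t n := by positivity
  field_simp

/-- The second hash as a family on seed tuples, keyed by `K2`-bit strings, valued in `𝔽₂^{m2S}`. [folklore] -/
noncomputable def h2fam (n : ℕ) (κ₂ : List.Vector Bool (S.K2 n)) (w : Fin (S.t n) → S.Blk n) : Fin (S.m2S n) → ZMod 2 :=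
  hashV (S.xLen n) (S.m2S n) κ₂.toList ((S.cW n).equiv w)

/-- The second hash family is pairwise independent on all seed tuples. [cite: AroraBarakCC2009, Def. 8.14 (pairwise independent hashing)] -/
theorem isPairwiseIndep_h2fam (n : ℕ) :
    IsPairwiseIndep (Finset.univ : Finset (List.Vector Bool (S.K2 n))) (S.h2fam n) Finset.univ := by
  have hK : S.m2S n * (S.xLen n + 1) ≤ S.K2 n := by
    unfold K2; exact Nat.mul_le_mul_right _ (S.m2S_le_xLen n)
  have h := isPairwiseIndep_hashV (m := S.xLen n) (k := S.m2S n) hK (Finset.univ.image (S.cW n).equiv)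
  refine (IsPairwiseIndep.comp_injOn h (e := (S.cW n).equiv) (S := Finset.univ) ((S.cW n).equiv.injective.injOn) ?_)
  intro a _; exact Finset.mem_image_of_mem _ (Finset.mem_univ a)

/-- The value of the second hash family is the candidate's second hash string. [folklore] -/
theorem encZ_h2fam (n : ℕ) (κ₂ : List.Vector Bool (S.K2 n)) (w : Fin (S.t n) → S.Blk n) :
    encZ (S.m2S n) (S.h2fam n κ₂ w) = hashStr (S.xLen n) (S.m2S n) κ₂.toList ((S.cW n).enc w) := by
  rw [h2fam, ← hashStr_toList]
  rfl

/-- **The test of Step 1**: on (committed pairs, key `κ₂`, hash value) average the distinguisher over `κ₁`.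
[cite: Luby1996, Lecture 10, Theorem 10.3 (proof, Step 1)] -/
noncomputable def T1 (D : RandAlg (List Bool) Bool) (n : ℕ) (z : Fin (S.t n) → List Bool × Bool)
    (q : List.Vector Bool (S.K2 n) × (Fin (S.m2S n) → ZMod 2)) : ℝ :=
  uniformAvg (S.K1 n) fun κ₁ => T D n (κ₁ ++ (q.1.toList ++ S.pay n (hashStr (S.t n * S.Lz n) (S.m1S n) κ₁ (S.encT n z)) (encZ (S.m2S n) q.2)))

/-- `0 ≤ T1 ≤ 1`. [folklore] -/
theorem T1_mem (D : RandAlg (List Bool) Bool) (n : ℕ) (z : Fin (S.t n) → List Bool × Bool)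
    (q : List.Vector Bool (S.K2 n) × (Fin (S.m2S n) → ZMod 2)) : 0 ≤ S.T1 D n z q ∧ S.T1 D n z q ≤ 1 :=
  ⟨uniformAvg_nonneg fun _ => (T_mem D n _).1, uniformAvg_le_one fun _ => (T_mem D n _).2⟩

/-- **The real side of Step 1** is the candidate's acceptance probability. [cite: Luby1996, Lecture 10, Theorem 10.3 (proof, Step 1)] -/
theorem step1_real (hS : S.WF) (D : RandAlg (List Bool) Bool) (n : ℕ) :
    (∑ κ₂ : List.Vector Bool (S.K2 n), ∑ w : Fin (S.t n) → S.Blk n, S.T1 D n (prodMap (S.Fm n) (S.t n) w) (κ₂, S.h2fam n κ₂ w)) /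
        ((Finset.univ : Finset (List.Vector Bool (S.K2 n))).card * Fintype.card (Fin (S.t n) → S.Blk n)) =
      (acceptPMF D n (seedEnsembleI S.candI S.aP S.kGood n) true).toReal := by
  rw [S.acc_real hS, uniformAvg_comm]
  conv_rhs => arg 2; ext κ₂; rw [uniformAvg_comm]
  rw [show S.xLen n = (S.cW n).len from rfl, uniformAvg₂_eq_div]
  refine congrArg₂ (· / ·) (Finset.sum_congr rfl fun κ₂ _ => Finset.sum_congr rfl fun w _ => ?_) rfl
  rw [T1]
  simp only [encZ_h2fam, S.zStr_enc, cW_len]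

/-- **The ideal side of Step 1** is the acceptance probability of `X S 0`. [cite: Luby1996, Lecture 10, Theorem 10.3 (proof, Step 1)] -/
theorem step1_ideal (hS : S.WF) (D : RandAlg (List Bool) Bool) (n : ℕ) :
    (∑ κ₂ : List.Vector Bool (S.K2 n), ∑ w : Fin (S.t n) → S.Blk n, ∑ u : Fin (S.m2S n) → ZMod 2,
        S.T1 D n (prodMap (S.Fm n) (S.t n) w) (κ₂, u)) /
        ((Finset.univ : Finset (List.Vector Bool (S.K2 n))).card * Fintype.card (Fin (S.t n) → S.Blk n) *
          Fintype.card (Fin (S.m2S n) → ZMod 2)) =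
      (acceptPMF D n (S.X (fun _ => 0) n) true).toReal := by
  rw [S.acc_X, uniformAvg_comm]
  conv_rhs => arg 2; ext κ₂; rw [uniformAvg_comm]; arg 2; ext R; rw [uniformAvg_comm]
  conv_rhs => arg 2; ext κ₂; rw [S.avg_zH_zero hS n (fun z => uniformAvg (S.m2S n) fun u₂ => uniformAvg (S.K1 n) fun κ₁ =>
    T D n (κ₁ ++ (κ₂ ++ S.pay n (hashStr (S.t n * S.Lz n) (S.m1S n) κ₁ z) u₂)))]
  rw [show S.xLen n = (S.cW n).len from rfl, uniformAvg₃_eq_div]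
  refine congrArg₂ (· / ·) (Finset.sum_congr rfl fun κ₂ _ => Finset.sum_congr rfl fun w _ =>
    Finset.sum_congr rfl fun u _ => ?_) rfl
  rw [T1, S.zStr_enc]

/-- **The conditional min-entropy available to Step 1**: with `5·t·√p ≤ 1`,
`m2S + 2(n+1) ≤ t·H(Y | Fm(Y)) − Δ` when `m2S > 0`. [cite: Luby1996, Lecture 10, Theorem 10.3 (proof, Step 1: `R(w) ≥ k(n)d(n) − k(n)^{5/6}`)] -/
theorem step1_exponent (n : ℕ) (hbind : 5 * (S.t n : ℝ) * Real.sqrt (S.pS n) ≤ 1) (hm2 : 0 < S.m2S n) :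
    ((S.m2S n + 2 * sl n : ℕ) : ℝ) ≤ S.t n * realEntropy (S.Fm n) - S.t n * S.ηS n * Real.logb 2 (Fintype.card (S.Blk n)) := by
  rw [t_mul_ηS, realEntropy_Fm]
  -- no truncation in `m2S`
  have hx : S.t4 n * (S.jStar n + 1) + S.Δ n + 2 * sl n + 1 ≤ S.xLen n := by
    by_contra hlt
    unfold m2S m2 at hm2
    omega
  have hm2eq : S.m2S n + 2 * sl n + (S.t4 n * (S.jStar n + 1) + S.Δ n + 1) = S.xLen n := by
    unfold m2S m2; omega
  have hreal : ((S.m2S n + 2 * sl n : ℕ) : ℝ) = S.xLen n - (S.t4 n * (S.jStar n + 1) + S.Δ n + 1 : ℕ) := by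
    rw [eq_sub_iff_add_eq]; exact_mod_cast hm2eq
  rw [hreal]
  have hxLen : (S.xLen n : ℝ) = S.t n * S.L0 n := by norm_cast
  have ht4 : (S.t n : ℝ) = 4 * S.t4 n := by norm_cast
  have hHF := S.HF_le n
  have hHC := S.HC_lt_jStar n
  have ht0 : (0 : ℝ) ≤ S.t n := Nat.cast_nonneg _
  have hsq : 0 ≤ Real.sqrt (S.pS n) := Real.sqrt_nonneg _
  push_cast
  rw [hxLen]
  -- `t·HF ≤ t4·(jStar+1) + 5t√p ≤ t4·(jStar+1) + 1`
  have h2 : (S.t n : ℝ) * S.HC n ≤ S.t n * (((S.jStar n : ℝ) + 1) / 4) := mul_le_mul_of_nonneg_left hHC.le ht0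
  have h3 : (S.t n : ℝ) * S.HF n ≤ S.t n * (S.HC n + 5 * Real.sqrt (S.pS n)) := mul_le_mul_of_nonneg_left hHF ht0
  have h1 : (S.t n : ℝ) * S.HF n ≤ S.t4 n * (S.jStar n + 1) + 1 := by
    rw [ht4] at h2 h3 hbind ⊢
    nlinarith
  linarith

/-- **Step 1** (Luby 1996, Thm. 10.3): replacing the hash of the seed blocks by fresh bits costs at most
`½·2^{−(n+1)} + e^{−2(n+1)}` in the acceptance probability of any distinguisher, once `5·t·√p ≤ 1`.
[cite: Luby1996, Lecture 10, Theorem 10.3 (proof, Step 1)] -/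
theorem step1 (hS : S.WF) (D : RandAlg (List Bool) Bool) (n : ℕ) (hbind : 5 * (S.t n : ℝ) * Real.sqrt (S.pS n) ≤ 1) :
    |(acceptPMF D n (seedEnsembleI S.candI S.aP S.kGood n) true).toReal - (acceptPMF D n (S.X (fun _ => 0) n) true).toReal| ≤
      2⁻¹ * (2 : ℝ) ^ (-((sl n : ℕ) : ℝ)) + Real.exp (-2 * ((n : ℝ) + 1)) := by
  classical
  rcases Nat.eq_zero_or_pos (S.m2S n) with hm2 | hm2
  · -- no second hash: the two distributions coincide
    have heq : (acceptPMF D n (seedEnsembleI S.candI S.aP S.kGood n) true).toReal =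
        (acceptPMF D n (S.X (fun _ => 0) n) true).toReal := by
      rw [S.acc_real hS, S.acc_X]
      refine uniformAvg_congr fun κ₁ _ => uniformAvg_congr fun κ₂ _ => ?_
      rw [S.avg_zH_zero hS n (fun z => uniformAvg (S.m2S n) fun u₂ =>
        T D n (κ₁ ++ (κ₂ ++ S.pay n (hashStr (S.t n * S.Lz n) (S.m1S n) κ₁ z) u₂)))]
      refine uniformAvg_congr fun x _ => ?_
      rw [hm2, uniformAvg_zero]
      simp [hashStr]
    rw [heq, sub_self, abs_zero]
    positivity
  · have hmain := smooth_cond_test (S.Fm n) (S.t_pos n) (S.ηS_nonneg n) (S.one_lt_card_Blk n)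
      (K := (Finset.univ : Finset (List.Vector Bool (S.K2 n)))) Finset.univ_nonempty (S.isPairwiseIndep_h2fam n)
      (k := S.m2S n + 2 * sl n) (by
        rw [Real.rpow_natCast]
        rw [← Real.rpow_natCast]
        exact Real.rpow_le_rpow_of_exponent_le (by norm_num) (S.step1_exponent n hbind hm2))
      (S.T1 D n) (fun c v => (S.T1_mem D n c v).1) (fun c v => (S.T1_mem D n c v).2)
    rw [S.step1_real hS, S.step1_ideal hS, exp_ηS] at hmain
    refine hmain.trans (add_le_add (le_of_eq ?_) le_rfl)
    -- `½ √(2^{m2S} / 2^{m2S + 2 sl}) = ½ 2^{-sl}`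
    rw [card_bvec, Nat.cast_pow, Nat.cast_ofNat, pow_add, div_mul_eq_div_div, div_self (by positivity), one_div]
    congr 1
    rw [show ((2 : ℝ) ^ (2 * sl n))⁻¹ = ((2 : ℝ) ^ (-((sl n : ℕ) : ℝ))) ^ 2 by
      rw [← Real.rpow_natCast, ← Real.rpow_neg (by norm_num), ← Real.rpow_mul_natCast (by norm_num)]
      congr 1; push_cast; ring]
    exact Real.sqrt_sq (by positivity)

end Step1

/-! ### Step 3: the hash of the ideal pairs is nearly uniform -/

section Step3

variable {S}

/-- The coded tuple as a bit vector (`t·Lz` bits, always). [folklore] -/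
def eT (n : ℕ) (z : Fin (S.t n) → List Bool × Bool) : List.Vector Bool (S.t n * S.Lz n) := ⟨S.encT n z, S.length_encT n z⟩

/-- The first hash as a family on coded tuples, keyed by `K1`-bit strings, valued in `𝔽₂^{m1S}`. [folklore] -/
noncomputable def h1fam (n : ℕ) (κ₁ : List.Vector Bool (S.K1 n)) (v : List.Vector Bool (S.t n * S.Lz n)) : Fin (S.m1S n) → ZMod 2 :=
  hashV (S.t n * S.Lz n) (S.m1S n) κ₁.toList v

/-- The first hash family is pairwise independent on all coded tuples. [cite: AroraBarakCC2009, Def. 8.14 (pairwise independent hashing)] -/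
theorem isPairwiseIndep_h1fam (n : ℕ) :
    IsPairwiseIndep (Finset.univ : Finset (List.Vector Bool (S.K1 n))) (S.h1fam n) Finset.univ := by
  have hK : S.m1S n * (S.t n * S.Lz n + 1) ≤ S.K1 n := by
    unfold K1; exact Nat.mul_le_mul_right _ (S.m1S_le_M1 n)
  exact isPairwiseIndep_hashV (m := S.t n * S.Lz n) (k := S.m1S n) hK Finset.univ

/-- The value of the first hash family is the first hash string of the coded tuple. [folklore] -/
theorem encZ_h1fam (n : ℕ) (κ₁ : List.Vector Bool (S.K1 n)) (z : Fin (S.t n) → List Bool × Bool) :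
    encZ (S.m1S n) (S.h1fam n κ₁ (S.eT n z)) = hashStr (S.t n * S.Lz n) (S.m1S n) κ₁.toList (S.encT n z) := by
  rw [h1fam, ← hashStr_toList]
  rfl

/-- **The coding is injective on tuples of ideal pairs** (their commitment strings are within the length bound).
[folklore] -/
theorem eT_injOn (hS : S.WF) (n : ℕ) :
    Set.InjOn (S.eT n) (Set.range fun w : Fin (S.t n) → S.Blk n × List.Vector Bool 1 => fun i => S.Gm n (w i)) := by
  intro z hz z' hz' h
  obtain ⟨w, rfl⟩ := hz
  obtain ⟨w', rfl⟩ := hz'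
  have h' := congrArg List.Vector.toList h
  simp only [eT, List.Vector.toList_mk] at h'
  exact S.encT_inj (fun ℓ => S.length_Cm_le hS n _) (fun ℓ => S.length_Cm_le hS n _) h'

/-- **The test of Step 3**: on (key `κ₁`, hash value) average the distinguisher over `κ₂` and `u₂`.
[cite: Luby1996, Lecture 10, Theorem 10.3 (proof, Step 3)] -/
noncomputable def T3 (D : RandAlg (List Bool) Bool) (n : ℕ) (q : List.Vector Bool (S.K1 n) × (Fin (S.m1S n) → ZMod 2)) : ℝ :=
  uniformAvg (S.K2 n) fun κ₂ => uniformAvg (S.m2S n) fun u₂ => T D n (q.1.toList ++ (κ₂ ++ S.pay n (encZ (S.m1S n) q.2) u₂))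

/-- `0 ≤ T3 ≤ 1`. [folklore] -/
theorem T3_mem (D : RandAlg (List Bool) Bool) (n : ℕ) (q : List.Vector Bool (S.K1 n) × (Fin (S.m1S n) → ZMod 2)) :
    0 ≤ S.T3 D n q ∧ S.T3 D n q ≤ 1 :=
  ⟨uniformAvg_nonneg fun _ => uniformAvg_nonneg fun _ => (T_mem D n _).1,
    uniformAvg_le_one fun _ => uniformAvg_le_one fun _ => (T_mem D n _).2⟩

/-- **The real side of Step 3** is the acceptance probability of `X S t`. [cite: Luby1996, Lecture 10, Theorem 10.3 (proof, Step 3)] -/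
theorem step3_real (hS : S.WF) (D : RandAlg (List Bool) Bool) (n : ℕ) :
    (∑ κ₁ : List.Vector Bool (S.K1 n), ∑ w : Fin (S.t n) → S.Blk n × List.Vector Bool 1,
        S.T3 D n (κ₁, S.h1fam n κ₁ (S.eT n fun i => S.Gm n (w i)))) /
        ((Finset.univ : Finset (List.Vector Bool (S.K1 n))).card * Fintype.card (Fin (S.t n) → S.Blk n × List.Vector Bool 1)) =
      (acceptPMF D n (S.X S.t n) true).toReal := by
  rw [S.acc_X]
  conv_rhs => arg 2; ext κ₁; rw [uniformAvg_comm]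
  rw [show S.rLen n = (S.cR n).len from rfl, uniformAvg₂_eq_div]
  refine congrArg₂ (· / ·) (Finset.sum_congr rfl fun κ₁ _ => Finset.sum_congr rfl fun w _ => ?_) rfl
  rw [T3]
  simp only [encZ_h1fam, S.zH_enc hS, S.pairH_t]
  rfl

/-- The clamped payload of two long enough strings is their prefix. [folklore] -/
theorem pay_eq_take (n : ℕ) {y₁ y₂ : List Bool} (h : S.xLen n + 1 ≤ y₁.length + y₂.length) :
    S.pay n y₁ y₂ = (y₁ ++ y₂).take (S.xLen n + 1) := by
  rw [pay, List.take_append_of_le_length (by rw [List.length_append]; exact h)]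

/-- **Averaging over the two uniform hash values and clamping is averaging over `xLen + 1` uniform bits.**
[folklore] -/
theorem avg_pay (n : ℕ) (G : List Bool → ℝ) :
    uniformAvg (S.m1S n) (fun u₁ => uniformAvg (S.m2S n) fun u₂ => G (S.pay n u₁ u₂)) = uniformAvg (S.xLen n + 1) G := by
  have hsum := S.xLen_lt_m1S_add_m2S n
  have h1 : uniformAvg (S.m1S n) (fun u₁ => uniformAvg (S.m2S n) fun u₂ => G (S.pay n u₁ u₂)) =
      uniformAvg (S.m1S n + S.m2S n) fun y => G ((y ++ List.replicate (S.xLen n + 1) false).take (S.xLen n + 1)) := by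
    rw [uniformAvg_append]
    rfl
  have h2 : uniformAvg (S.m1S n + S.m2S n) (fun y => G ((y ++ List.replicate (S.xLen n + 1) false).take (S.xLen n + 1))) =
      uniformAvg (S.m1S n + S.m2S n) fun y => G (y.take (S.xLen n + 1)) :=
    uniformAvg_congr fun y hy => by rw [List.take_append_of_le_length (by rw [hy]; exact hsum)]
  have h3 := uniformAvg_take_left (S.xLen n + 1) (S.m1S n + S.m2S n - (S.xLen n + 1)) G
  rw [Nat.add_sub_cancel' hsum] at h3
  rw [h1, h2, h3]

/-- **The uniform side of Step 3** is the acceptance probability of the uniform string: uniform hash values of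
`m1S + m2S ≥ xLen + 1` bits, clamped, are `xLen + 1` uniform bits. [cite: Luby1996, Lecture 10, Theorem 10.3 (proof: "a random string of the same length")] -/
theorem step3_unif (D : RandAlg (List Bool) Bool) (n : ℕ) :
    (∑ κ₁ : List.Vector Bool (S.K1 n), ∑ u : Fin (S.m1S n) → ZMod 2, S.T3 D n (κ₁, u)) /
        ((Finset.univ : Finset (List.Vector Bool (S.K1 n))).card * Fintype.card (Fin (S.m1S n) → ZMod 2)) =
      (acceptPMF D n (uniformBits (S.a n + 1)) true).toReal := by
  rw [S.acc_unif]
  -- the right side as `E_{κ₁} E_{u₁} T3(κ₁, u₁)`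
  have hR : (uniformAvg (S.K1 n) fun κ₁ => uniformAvg (S.K2 n) fun κ₂ => uniformAvg (S.xLen n + 1) fun y => T D n (κ₁ ++ (κ₂ ++ y))) =
      uniformAvg (S.K1 n) fun κ₁ => uniformAvg (S.m1S n) fun u₁ => uniformAvg (S.K2 n) fun κ₂ => uniformAvg (S.m2S n) fun u₂ =>
        T D n (κ₁ ++ (κ₂ ++ S.pay n u₁ u₂)) := by
    refine uniformAvg_congr fun κ₁ _ => ?_
    conv_rhs => rw [uniformAvg_comm]
    refine uniformAvg_congr fun κ₂ _ => ?_
    exact (S.avg_pay n fun y => T D n (κ₁ ++ (κ₂ ++ y))).symm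
  rw [hR]
  conv_rhs => arg 2; ext κ₁; rw [uniformAvg_eq_sum_encZ]
  rw [uniformAvg, Finset.card_univ, card_vector, Fintype.card_bool]
  simp only [Finset.sum_div]
  refine Finset.sum_congr rfl fun κ₁ _ => Finset.sum_congr rfl fun u _ => ?_
  rw [T3]
  push_cast
  rw [div_div, mul_comm]

/-- `|Blk × {0,1}| = 2^{L0+1}`. [folklore] -/
theorem card_BlkU (n : ℕ) : Fintype.card (S.Blk n × List.Vector Bool 1) = 2 ^ (S.L0 n + 1) := by
  rw [Fintype.card_prod, card_Blk, card_vector, Fintype.card_bool, pow_one, pow_succ]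

/-- `head` is injective on one-bit vectors. [folklore] -/
theorem head_injective_one : Function.Injective (List.Vector.head : List.Vector Bool 1 → Bool) := by
  intro v w h
  apply List.Vector.ext
  intro i
  have hi : i = 0 := Fin.ext (by omega)
  subst hi
  rw [List.Vector.get_zero, List.Vector.get_zero]
  exact h

/-- **The ideal pair has entropy `H(C) + 1`.** [cite: Luby1996, Lecture 10, Theorem 10.3 (`ent(𝓔_n) ≥ ent(f(X)) + p(n)`)] -/
theorem mapEntropy_Gm (n : ℕ) : mapEntropy univ (S.Gm n) = S.HC n + 1 := by
  rw [Gm_eq, ← Finset.univ_product_univ, Cryptography.mapEntropy_product Finset.univ_nonempty Finset.univ_nonempty,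
    Cryptography.mapEntropy_of_injective _ head_injective_one, Finset.card_univ, card_vector, Fintype.card_bool, pow_one, HC]
  norm_num

/-- `η₃ n = Δ / (t·(L0+1))`: the normalised deviation of Step 3 (`t·η₃·log₂|Blk × {0,1}| = Δ`). [folklore] -/
noncomputable def η₃ (n : ℕ) : ℝ := (S.Δ n : ℝ) / (S.t n * (S.L0 n + 1))

/-- `0 ≤ η₃`. [folklore] -/
theorem η₃_nonneg (n : ℕ) : 0 ≤ S.η₃ n := by unfold η₃; positivity

/-- `t·η₃·log₂|Blk × {0,1}| = Δ`. [folklore] -/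
theorem t_mul_η₃ (n : ℕ) : (S.t n : ℝ) * S.η₃ n * Real.logb 2 (Fintype.card (S.Blk n × List.Vector Bool 1)) = S.Δ n := by
  rw [card_BlkU, Nat.cast_pow, Nat.cast_two, Real.logb_pow, Real.logb_self_eq_one (by norm_num), mul_one, η₃]
  have ht : (0 : ℝ) < S.t n := by exact_mod_cast S.t_pos n
  push_cast
  field_simp

/-- `e^{−2·t·η₃²} ≤ e^{−(n+1)/2}` (`2Δ²/(t(L0+1)²) = 2(n+1)·(L0/(L0+1))² ≥ (n+1)/2`). [folklore] -/
theorem exp_η₃_le (n : ℕ) : Real.exp (-2 * S.t n * S.η₃ n ^ 2) ≤ Real.exp (-(((n : ℝ) + 1) / 2)) := by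
  rw [Real.exp_le_exp]
  unfold η₃
  have ht : (S.t n : ℝ) = 4 * (S.cst n : ℝ) ^ 2 * (n + 1) := by unfold t t4; push_cast; ring
  have hΔ : (S.Δ n : ℝ) = S.L0 n * (2 * S.cst n * (n + 1)) := by unfold Δ; push_cast; ring
  have hL : (1 : ℝ) ≤ S.L0 n := by exact_mod_cast S.one_le_L0 n
  have hc : (0 : ℝ) < S.cst n := by have : 1 ≤ S.cst n := by unfold cst; omega
                                    exact_mod_cast this
  have hn : (0 : ℝ) < (n : ℝ) + 1 := by positivity
  have htpos : (0 : ℝ) < S.t n := by rw [ht]; positivity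
  -- `2 t η₃² = 2 Δ²/(t (L0+1)²) = 2 (n+1) L0² / (L0+1)² ≥ (n+1)/2`
  have key : 2 * (S.t n : ℝ) * ((S.Δ n : ℝ) / (S.t n * (S.L0 n + 1))) ^ 2 = 2 * ((n : ℝ) + 1) * ((S.L0 n : ℝ) / (S.L0 n + 1)) ^ 2 := by
    rw [ht, hΔ]; field_simp; ring
  have hratio : (1 : ℝ) / 4 ≤ ((S.L0 n : ℝ) / (S.L0 n + 1)) ^ 2 := by
    have h12 : (1 : ℝ) / 2 ≤ (S.L0 n : ℝ) / (S.L0 n + 1) := by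
      rw [div_le_div_iff₀ (by norm_num) (by linarith)]; linarith
    nlinarith
  have : -2 * (S.t n : ℝ) * ((S.Δ n : ℝ) / (S.t n * (S.L0 n + 1))) ^ 2 = -(2 * (S.t n : ℝ) * ((S.Δ n : ℝ) / (S.t n * (S.L0 n + 1))) ^ 2) := by ring
  rw [this, key]
  nlinarith

/-- For `n ≥ 1` the tail of Step 3 is at most `½`. [folklore] -/
theorem exp_η₃_le_half {n : ℕ} (hn : 1 ≤ n) : Real.exp (-2 * S.t n * S.η₃ n ^ 2) ≤ 2⁻¹ := by
  refine (S.exp_η₃_le n).trans ?_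
  have hn' : (1 : ℝ) ≤ n := by exact_mod_cast hn
  have h1 : Real.exp (-(((n : ℝ) + 1) / 2)) ≤ Real.exp (-1) := Real.exp_le_exp.2 (by linarith)
  have h2 : Real.exp (-1) ≤ 2⁻¹ := by
    rw [Real.exp_neg, inv_le_inv₀ (Real.exp_pos 1) (by norm_num)]
    have := Real.add_one_le_exp (1 : ℝ)
    linarith
  exact h1.trans h2

/-- **The exponent of Step 3**: `1 + m1S − (t·H(Gm) − Δ) ≤ −2·sl` (from `t4·jStar ≤ t·H(C)`).
[cite: Luby1996, Lecture 10, Theorem 10.3 (proof, Step 3: `ent_min(Z') ≥ ent(𝓔_n)k(n) − k(n)^{5/6}`)] -/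
theorem step3_exponent (n : ℕ) :
    (1 : ℝ) + (S.m1S n : ℕ) - (S.t n * mapEntropy univ (S.Gm n) - S.t n * S.η₃ n * Real.logb 2 (Fintype.card (S.Blk n × List.Vector Bool 1))) ≤
      -(2 * sl n : ℕ) := by
  rw [t_mul_η₃, mapEntropy_Gm]
  have h3 := S.three_t4_ge n
  have hm1 : S.m1S n + S.Δ n + 2 * sl n + 1 = S.t4 n * S.jStar n + S.t n := by
    unfold m1S m1 t; omega
  have hreal : ((S.m1S n : ℕ) : ℝ) = S.t4 n * S.jStar n + S.t n - S.Δ n - (2 * sl n : ℕ) - 1 := by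
    have h : ((S.m1S n + S.Δ n + 2 * sl n + 1 : ℕ) : ℝ) = ((S.t4 n * S.jStar n + S.t n : ℕ) : ℝ) := by exact_mod_cast hm1
    push_cast at h ⊢
    linarith
  have ht4 : (S.t n : ℝ) = 4 * S.t4 n := by norm_cast
  have hj : (S.jStar n : ℝ) / 4 ≤ S.HC n := S.jStar_le_HC n
  have ht0 : (0 : ℝ) ≤ S.t4 n := Nat.cast_nonneg _
  have hkey : (S.t4 n : ℝ) * S.jStar n ≤ S.t n * S.HC n := by
    rw [ht4]; nlinarith
  rw [hreal]
  push_cast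
  linarith

/-- **Step 3** (Luby 1996, Thm. 10.3): hashing the ideal pairs and clamping yields, up to
`½·2^{−(n+1)} + e^{−(n+1)/2}` in the acceptance probability of any distinguisher, the uniform string of length
`a n + 1` (for `n ≥ 1`). [cite: Luby1996, Lecture 10, Theorem 10.3 (proof, Step 3)] -/
theorem step3 (hS : S.WF) (D : RandAlg (List Bool) Bool) {n : ℕ} (hn : 1 ≤ n) :
    |(acceptPMF D n (S.X S.t n) true).toReal - (acceptPMF D n (uniformBits (S.a n + 1)) true).toReal| ≤
      2⁻¹ * (2 : ℝ) ^ (-((sl n : ℕ) : ℝ)) + Real.exp (-(((n : ℝ) + 1) / 2)) := by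
  classical
  have hΩ : 1 < Fintype.card (S.Blk n × List.Vector Bool 1) := by
    rw [card_BlkU]; exact Nat.one_lt_two_pow (by omega)
  have hmain := smooth_test (S.Gm n) (S.t_pos n) (S.η₃_nonneg n) hΩ (S.exp_η₃_le_half hn)
    (K := (Finset.univ : Finset (List.Vector Bool (S.K1 n)))) Finset.univ_nonempty (S.isPairwiseIndep_h1fam n)
    (e := S.eT n) (S.eT_injOn hS n) (fun w => Finset.mem_univ _)
    (S.T3 D n) (fun v => (S.T3_mem D n v).1) (fun v => (S.T3_mem D n v).2)
  rw [S.step3_real hS, S.step3_unif] at hmain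
  refine hmain.trans (add_le_add ?_ (S.exp_η₃_le n))
  -- `√(2·2^{m1S}·2^{−(tH − Δ)}) ≤ 2^{−sl}`
  refine mul_le_mul_of_nonneg_left ?_ (by norm_num)
  have hexp := S.step3_exponent n
  rw [card_bvec, Nat.cast_pow, Nat.cast_ofNat]
  set E : ℝ := S.t n * mapEntropy univ (S.Gm n) - S.t n * S.η₃ n * Real.logb 2 (Fintype.card (S.Blk n × List.Vector Bool 1)) with hE
  have h2 : (2 : ℝ) * (2 : ℝ) ^ S.m1S n * (2 : ℝ) ^ (-E) = (2 : ℝ) ^ ((1 : ℝ) + (S.m1S n : ℕ) - E) := by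
    rw [show (1 : ℝ) + (S.m1S n : ℕ) - E = ((1 : ℝ) + (S.m1S n : ℕ)) + (-E) by ring, Real.rpow_add (by norm_num),
      Real.rpow_add (by norm_num), Real.rpow_one, Real.rpow_natCast]
  rw [h2]
  calc Real.sqrt ((2 : ℝ) ^ ((1 : ℝ) + (S.m1S n : ℕ) - E))
      ≤ Real.sqrt ((2 : ℝ) ^ (-((2 * sl n : ℕ) : ℝ))) :=
        Real.sqrt_le_sqrt (Real.rpow_le_rpow_of_exponent_le (by norm_num) hexp)
    _ = (2 : ℝ) ^ (-((sl n : ℕ) : ℝ)) := by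
        rw [show (2 : ℝ) ^ (-((2 * sl n : ℕ) : ℝ)) = ((2 : ℝ) ^ (-((sl n : ℕ) : ℝ))) ^ 2 by
          rw [← Real.rpow_mul_natCast (by norm_num)]
          congr 1; push_cast; ring]
        exact Real.sqrt_sq (by positivity)

end Step3

end Setup

end ComPRG

end Literature.Computability.Cryptography
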